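import Literature.Geometry.Lorentzian.CoordChristoffelDerivative
import HarnessLib

/-!
# Continuity of the coordinate curvature in the 2-jet of the components

In the `MetricCoord` framework (`CoordCurvature.lean`: `sharpAt`, `koszulCLM`, `chrAt`, `riemAt`,
`ricAt` of metric components `G : E → (E →L E →L ℝ)` on an open `V`, `IsMetricOn G V`) the
curvature objects at a point `x ∈ V` are explicit continuous functions of the 2-jet
`(G(x), DG(x), D²G(x))`: `♯ₓ = G(x)⁻¹`, `Γₓ = ½ ♯ₓ ∘ koszulOp(DG(x))` (`chrAt_apply_eq_comp`),
`D♯(v) = −♯ ∘ DG(v) ∘ ♯` (`IsMetricOn.fderiv_sharpAt`),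
`DΓ(v)(X) = ½ (D♯(v) ∘ K(X) + ♯ ∘ koszulOp(D²G(v))(X))` (`IsMetricOn.fderiv_chrAt_apply_eq`),
`R = DΓ − DΓ + ΓΓ − ΓΓ`, `Ric = tr R`. Hence:

**Theorem (`tendsto_ricAt_apply`).** If `Gᵢ`, `G` are metric components on `V ∋ x` and along a
filter `l` the jets converge at `x` — `Gᵢ(x) → G(x)`, `DGᵢ(x) → DG(x)`, `D²Gᵢ(x) → D²G(x)` — then
`Ric[Gᵢ]ₓ(Y, Z) → Ric[G]ₓ(Y, Z)` for all `Y, Z` (and likewise `♯`, `Γ`, `DΓ`, `R`). In particular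
(`ricAt_eq_zero_of_tendsto`) **Ricci-flatness passes to `C²` limits of metric components**: if
eventually `Ric[Gᵢ]ₓ = 0` then `Ric[G]ₓ = 0` — the vacuum equations are closed under `C²_loc`
convergence (used for pointed `C²_loc` limits of vacuum spacetimes, `VacuumLocalLimit.lean`).

## References
* B. O'Neill, *Semi-Riemannian geometry*, Academic Press 1983, Ch. 3, Prop. 3.13, Lemma 3.38,
  Lemma 3.52. [ONeill1983]
* P. Petersen, *Riemannian Geometry*, 2nd ed., GTM 171, Springer 2006, Ch. 10, §3.2 (curvature
  under `C²` convergence of metrics). [Petersen2006]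
-/

noncomputable section

set_option maxSynthPendingDepth 3

open Set Filter Topology ContinuousLinearMap

namespace Literature.Geometry.Lorentzian

/-! ### `Tendsto` lemmas for compositions and evaluations of continuous linear maps -/

section TendstoCLM

variable {ι : Type*} {l : Filter ι} {E₁ E₂ E₃ : Type*} [NormedAddCommGroup E₁] [NormedSpace ℝ E₁]
  [NormedAddCommGroup E₂] [NormedSpace ℝ E₂] [NormedAddCommGroup E₃] [NormedSpace ℝ E₃]

/-- Composition of convergent families of continuous linear maps converges. [folklore] -/
theorem tendsto_clm_comp {g : ι → E₂ →L[ℝ] E₃} {f : ι → E₁ →L[ℝ] E₂} {A : E₂ →L[ℝ] E₃}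
    {B : E₁ →L[ℝ] E₂} (hg : Tendsto g l (𝓝 A)) (hf : Tendsto f l (𝓝 B)) :
    Tendsto (fun i ↦ (g i).comp (f i)) l (𝓝 (A.comp B)) :=
  ((compL ℝ E₁ E₂ E₃).continuous₂.tendsto (A, B)).comp (hg.prodMk_nhds hf)

/-- Evaluation of a convergent family of continuous linear maps at a convergent family of vectors
converges. [folklore] -/
theorem tendsto_clm_apply {f : ι → E₁ →L[ℝ] E₂} {v : ι → E₁} {A : E₁ →L[ℝ] E₂} {a : E₁}
    (hf : Tendsto f l (𝓝 A)) (hv : Tendsto v l (𝓝 a)) :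
    Tendsto (fun i ↦ f i (v i)) l (𝓝 (A a)) :=
  (isBoundedBilinearMap_apply.continuous.tendsto (A, a)).comp (hf.prodMk_nhds hv)

/-- Evaluation of a convergent family of continuous linear maps at a fixed vector converges.
[folklore] -/
theorem tendsto_clm_apply_const {f : ι → E₁ →L[ℝ] E₂} {A : E₁ →L[ℝ] E₂} (hf : Tendsto f l (𝓝 A))
    (a : E₁) : Tendsto (fun i ↦ f i a) l (𝓝 (A a)) :=
  ((ContinuousLinearMap.apply ℝ E₂ a).continuous.tendsto A).comp hf

end TendstoCLM

namespace MetricCoord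

variable {ι : Type*} {l : Filter ι} {E : Type*} [NormedAddCommGroup E] [NormedSpace ℝ E]
  [CompleteSpace E] {Gs : ι → E → E →L[ℝ] E →L[ℝ] ℝ} {G : E → E →L[ℝ] E →L[ℝ] ℝ} {V : Set E}
  {x : E}

/-- **Index raising is continuous in the 0-jet**: `♯[Gᵢ]ₓ → ♯[G]ₓ` if `Gᵢ(x) → G(x)` with `G(x)`
invertible (inversion of continuous linear maps is continuous at invertible maps). [folklore] -/
theorem tendsto_sharpAt (hG : IsMetricOn G V) (hx : x ∈ V) (h0 : Tendsto (fun i ↦ Gs i x) l (𝓝 (G x))) :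
    Tendsto (fun i ↦ sharpAt (Gs i) x) l (𝓝 (sharpAt G x)) :=
  ((hG.isInvertible x hx).contDiffAt_map_inverse (n := 0)).continuousAt.tendsto.comp h0

omit [CompleteSpace E] in
/-- **The Koszul form is continuous in the 1-jet**: `K[Gᵢ]ₓ → K[G]ₓ` if `DGᵢ(x) → DG(x)`. [folklore] -/
theorem tendsto_koszulCLM (h1 : Tendsto (fun i ↦ fderiv ℝ (Gs i) x) l (𝓝 (fderiv ℝ G x))) :
    Tendsto (fun i ↦ koszulCLM (Gs i) x) l (𝓝 (koszulCLM G x)) :=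
  (koszulOp.continuous.tendsto _).comp h1

/-- **The Christoffel map is continuous in the 1-jet**: `Γ[Gᵢ]ₓ(X) → Γ[G]ₓ(X)`. [cite: ONeill1983, Ch. 3, Prop. 3.13] -/
theorem tendsto_chrAt_apply (hG : IsMetricOn G V) (hx : x ∈ V)
    (h0 : Tendsto (fun i ↦ Gs i x) l (𝓝 (G x)))
    (h1 : Tendsto (fun i ↦ fderiv ℝ (Gs i) x) l (𝓝 (fderiv ℝ G x))) (X : E) :
    Tendsto (fun i ↦ chrAt (Gs i) x X) l (𝓝 (chrAt G x X)) := by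
  have h : Tendsto (fun i ↦ (2⁻¹ : ℝ) • (sharpAt (Gs i) x).comp (koszulCLM (Gs i) x X)) l
      (𝓝 ((2⁻¹ : ℝ) • (sharpAt G x).comp (koszulCLM G x X))) :=
    (tendsto_clm_comp (tendsto_sharpAt hG hx h0)
      (tendsto_clm_apply_const (tendsto_koszulCLM h1) X)).const_smul _
  simp only [← chrAt_apply_eq_comp] at h
  exact h

/-- Evaluated form: `Γ[Gᵢ]ₓ(X, Y) → Γ[G]ₓ(X, Y)`. [cite: ONeill1983, Ch. 3, Prop. 3.13] -/
theorem tendsto_chrAt_apply₂ (hG : IsMetricOn G V) (hx : x ∈ V)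
    (h0 : Tendsto (fun i ↦ Gs i x) l (𝓝 (G x)))
    (h1 : Tendsto (fun i ↦ fderiv ℝ (Gs i) x) l (𝓝 (fderiv ℝ G x))) (X Y : E) :
    Tendsto (fun i ↦ chrAt (Gs i) x X Y) l (𝓝 (chrAt G x X Y)) :=
  tendsto_clm_apply_const (tendsto_chrAt_apply hG hx h0 h1 X) Y

/-- **The derivative of index raising is continuous in the 1-jet**: `D♯[Gᵢ](v) → D♯[G](v)`
(`D♯(v) = −♯ ∘ DG(v) ∘ ♯`). [folklore] -/
theorem tendsto_fderiv_sharpAt_apply (hGs : ∀ i, IsMetricOn (Gs i) V) (hG : IsMetricOn G V)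
    (hx : x ∈ V) (h0 : Tendsto (fun i ↦ Gs i x) l (𝓝 (G x)))
    (h1 : Tendsto (fun i ↦ fderiv ℝ (Gs i) x) l (𝓝 (fderiv ℝ G x))) (v : E) :
    Tendsto (fun i ↦ fderiv ℝ (sharpAt (Gs i)) x v) l (𝓝 (fderiv ℝ (sharpAt G) x v)) := by
  have hs := tendsto_sharpAt hG hx h0
  have h : Tendsto (fun i ↦ -(sharpAt (Gs i) x).comp ((fderiv ℝ (Gs i) x v).comp (sharpAt (Gs i) x)))
      l (𝓝 (-(sharpAt G x).comp ((fderiv ℝ G x v).comp (sharpAt G x)))) :=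
    (tendsto_clm_comp hs (tendsto_clm_comp (tendsto_clm_apply_const h1 v) hs)).neg
  rw [hG.fderiv_sharpAt hx v]
  refine h.congr fun i ↦ ?_
  rw [(hGs i).fderiv_sharpAt hx v]

/-- **The derivative of the Christoffel map is continuous in the 2-jet**:
`DΓ[Gᵢ](v)(X) → DΓ[G](v)(X)`. [cite: ONeill1983, Ch. 3, Prop. 3.13] -/
theorem tendsto_fderiv_chrAt_apply₂ (hGs : ∀ i, IsMetricOn (Gs i) V) (hG : IsMetricOn G V)
    (hx : x ∈ V) (h0 : Tendsto (fun i ↦ Gs i x) l (𝓝 (G x)))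
    (h1 : Tendsto (fun i ↦ fderiv ℝ (Gs i) x) l (𝓝 (fderiv ℝ G x)))
    (h2 : Tendsto (fun i ↦ fderiv ℝ (fderiv ℝ (Gs i)) x) l (𝓝 (fderiv ℝ (fderiv ℝ G) x)))
    (v X : E) :
    Tendsto (fun i ↦ fderiv ℝ (chrAt (Gs i)) x v X) l (𝓝 (fderiv ℝ (chrAt G) x v X)) := by
  have hA := tendsto_fderiv_sharpAt_apply hGs hG hx h0 h1 v
  have hK := tendsto_clm_apply_const (tendsto_koszulCLM (Gs := Gs) h1) X
  have hS := tendsto_sharpAt hG hx h0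
  have hD2 : Tendsto (fun i ↦ koszulOp (fderiv ℝ (fderiv ℝ (Gs i)) x v) X) l
      (𝓝 (koszulOp (fderiv ℝ (fderiv ℝ G) x v) X)) :=
    tendsto_clm_apply_const ((koszulOp.continuous.tendsto _).comp (tendsto_clm_apply_const h2 v)) X
  have h : Tendsto (fun i ↦ (2⁻¹ : ℝ) • ((fderiv ℝ (sharpAt (Gs i)) x v).comp (koszulCLM (Gs i) x X)
      + (sharpAt (Gs i) x).comp (koszulOp (fderiv ℝ (fderiv ℝ (Gs i)) x v) X))) l
      (𝓝 ((2⁻¹ : ℝ) • ((fderiv ℝ (sharpAt G) x v).comp (koszulCLM G x X)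
        + (sharpAt G x).comp (koszulOp (fderiv ℝ (fderiv ℝ G) x v) X)))) :=
    ((tendsto_clm_comp hA hK).add (tendsto_clm_comp hS hD2)).const_smul _
  rw [hG.fderiv_chrAt_apply_eq hx v X]
  refine h.congr fun i ↦ ?_
  rw [(hGs i).fderiv_chrAt_apply_eq hx v X]

/-- **The curvature endomorphism is continuous in the 2-jet**: `R[Gᵢ]ₓ(X,Y)Z → R[G]ₓ(X,Y)Z`.
[cite: ONeill1983, Ch. 3, Lemma 3.38] -/
theorem tendsto_riemAt_apply (hGs : ∀ i, IsMetricOn (Gs i) V) (hG : IsMetricOn G V)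
    (hx : x ∈ V) (h0 : Tendsto (fun i ↦ Gs i x) l (𝓝 (G x)))
    (h1 : Tendsto (fun i ↦ fderiv ℝ (Gs i) x) l (𝓝 (fderiv ℝ G x)))
    (h2 : Tendsto (fun i ↦ fderiv ℝ (fderiv ℝ (Gs i)) x) l (𝓝 (fderiv ℝ (fderiv ℝ G) x)))
    (X Y Z : E) :
    Tendsto (fun i ↦ riemAt (Gs i) x X Y Z) l (𝓝 (riemAt G x X Y Z)) := by
  have hDXY := tendsto_clm_apply_const (tendsto_fderiv_chrAt_apply₂ hGs hG hx h0 h1 h2 X Y) Z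
  have hDYX := tendsto_clm_apply_const (tendsto_fderiv_chrAt_apply₂ hGs hG hx h0 h1 h2 Y X) Z
  have hΓX := tendsto_chrAt_apply hG hx h0 h1 X
  have hΓY := tendsto_chrAt_apply hG hx h0 h1 Y
  have hXYZ := tendsto_clm_apply hΓX (tendsto_clm_apply_const hΓY Z)
  have hYXZ := tendsto_clm_apply hΓY (tendsto_clm_apply_const hΓX Z)
  simp only [riemAt_apply]
  exact ((hDXY.sub hDYX).add hXYZ).sub hYXZ

/-- **The Ricci form is continuous in the 2-jet**: `Ric[Gᵢ]ₓ(Y, Z) → Ric[G]ₓ(Y, Z)` (the trace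
expanded in a basis, `ricAt_eq_sum_coord`). [cite: ONeill1983, Ch. 3, Lemma 3.52] -/
theorem tendsto_ricAt_apply [FiniteDimensional ℝ E] (hGs : ∀ i, IsMetricOn (Gs i) V)
    (hG : IsMetricOn G V) (hx : x ∈ V) (h0 : Tendsto (fun i ↦ Gs i x) l (𝓝 (G x)))
    (h1 : Tendsto (fun i ↦ fderiv ℝ (Gs i) x) l (𝓝 (fderiv ℝ G x)))
    (h2 : Tendsto (fun i ↦ fderiv ℝ (fderiv ℝ (Gs i)) x) l (𝓝 (fderiv ℝ (fderiv ℝ G) x)))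
    (Y Z : E) :
    Tendsto (fun i ↦ ricAt (Gs i) x Y Z) l (𝓝 (ricAt G x Y Z)) := by
  let b := Module.finBasis ℝ E
  simp only [ricAt_eq_sum_coord b]
  refine tendsto_finsetSum _ fun j _ ↦ ?_
  have hc : Continuous (b.coord j) := (b.coord j).continuous_of_finiteDimensional
  exact (hc.tendsto _).comp (tendsto_riemAt_apply hGs hG hx h0 h1 h2 (b j) Y Z)

/-- **Ricci-flatness passes to `C²` limits of metric components**: if the jets of `Gᵢ` converge
to the jet of `G` at `x` along a nontrivial filter and `Ric[Gᵢ]ₓ = 0` eventually, then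
`Ric[G]ₓ = 0`. [cite: Petersen2006, Ch. 10 §3.2] -/
theorem ricAt_eq_zero_of_tendsto [FiniteDimensional ℝ E] [l.NeBot] (hGs : ∀ i, IsMetricOn (Gs i) V)
    (hG : IsMetricOn G V) (hx : x ∈ V) (h0 : Tendsto (fun i ↦ Gs i x) l (𝓝 (G x)))
    (h1 : Tendsto (fun i ↦ fderiv ℝ (Gs i) x) l (𝓝 (fderiv ℝ G x)))
    (h2 : Tendsto (fun i ↦ fderiv ℝ (fderiv ℝ (Gs i)) x) l (𝓝 (fderiv ℝ (fderiv ℝ G) x)))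
    (hric : ∀ᶠ i in l, ricAt (Gs i) x = 0) : ricAt G x = 0 := by
  ext Y Z
  have h := tendsto_ricAt_apply hGs hG hx h0 h1 h2 Y Z
  have h' : Tendsto (fun i ↦ ricAt (Gs i) x Y Z) l (𝓝 0) :=
    tendsto_const_nhds.congr' (hric.mono fun i hi ↦ by
      show (0 : ℝ) = ricAt (Gs i) x Y Z
      rw [hi]; rfl)
  exact tendsto_nhds_unique h h'

end MetricCoord

end Literature.Geometry.Lorentzian

end
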